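import Literature.NumberTheory.GaloisRepresentations.IdeleClassBarSRelativeLayers
import Literature.NumberTheory.GaloisRepresentations.IdeleClassBarSInvariant
import Literature.Algebra.Homology.DiscreteRepLayerRestriction
import HarnessLib

/-!
# The invariant maps of the RELATIVE layers of `C̄_S` at an open subgroup `W ≤ G_S`:
# `inv_{H_E} : H²(↥W ⧸ (V̄_E ∩ W), (Res_W C̄_S)^{V̄_E ∩ W}) ⥲ (1/|H_E|)ℤ/ℤ`, compatible with door-c4's transitions and
# restriction maps (Serre XI §2–§3; Harari Thm. 17.2; the layers of `inv_W : Ext²_{C_W}(ℤ, Res_W C̄_S) →+ ℚ/ℤ`)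

Topic `NumberTheory/GaloisRepresentations`; namespace `Literature.NumberTheory.GaloisRepresentations.IdeleClassBar`.
Definitions with bodies (`relLayerInflHomS` — plumbing: the transition `C_S(E) → C_S(E')` read on the images `H_E`, `H_{E'}`
of `W`, as a pair morphism over bsd-line-x1-p1-w3's restriction `subgroupImageSRes` —, `relLayerInvS`) and theorems; NO
named fact, no `sorry`, no instance, no notation; number fields in `Type`.  Sequel to bsd-line-x1-p1-w3's
`IdeleClassBarSRelativeLayers` (`subgroupImageS S hE W = H_E ≤ Gal(E/K)`, `subgroupImageSEquiv`, `relLayerRepS S W E`,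
`relLayerSCohomologyIso S hE hEW n : Hⁿ(↥W ⧸ (V̄_E ∩ W), (Res_W C̄_S)^{V̄_E ∩ W}) ≅ Hⁿ(H_E, Res_{H_E} C_S(E))`), to this
seat's `IdeleClassBarSInvariant` (top level: `layerInvS`, `invS`, `layerSCohomologyIso_hom_stepG`) and
`IdeleClassModUnitsSInvariant(Tower)` (`invSub` of THE class of `C_S(E)`: `inv_H ∘ res = [G:H] · inv`, values, and
`inv_{H_M} ∘ Inf' = inv_{H_E}` when `|H_M| = [M:E] |H_E|`), and to door-c4's `DiscreteRepLayerRestriction` (`extRes_inflG`,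
`traceQuotMap`, `traceLayerHom`) / `DiscreteRepLayerColimitDesc` (`LayerColimit.desc`).

THE POINT (the `S`-version of door-c4 g16's `IdeleClassBarRelativeInvariant` §16 + `…InvariantSubgroup` §17–§18a).
For an open subgroup `W ≤ G_S` the cohomology `H²(W, C̄_S) = Ext²_{C_W}(ℤ, Res_W C̄_S)` is the colimit over the TRACE
layers `V̄_E ∩ W` (`E ⊂ K_S` with `V̄_E ≤ W`) of `H²(H_E, C_S(E))`, `H_E ≤ Gal(E/K)` the image of `W` — a class module
restricted to a subgroup, with invariant `inv_{H_E} : res ū_{E/K} ↦ 1/|H_E|`.  §1: the two COMPATIBILITY SQUARES under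
w3's isomorphisms — door-c4's transition `stepG` between trace layers IS the relative inflation `Hⁿ(π', j')` of w4's
currency (`π' = subgroupImageSRes : H_{E'} → H_E` w3's restriction, `j'` the transition `C_S(E) → C_S(E')` on vectors), and door-c4's layer
restriction map `Hⁿ(traceQuotMap, traceLayerHom)` IS the finite-level restriction `res_{H_E}`.  §2: the relative layer
invariants `relLayerInvS`, injective, range `{q : |H_E| • q = 0}`, index bookkeeping `[Gal(E/K) : H_E] = [G_S : W]`,
`|H_{E'}| = [E':E] |H_E|`, and their compatibility with `stepG` (this seat's `invSub_classModUnits_map_relative`).  The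
descent `inv_W : Ext²_{C_W}(ℤ, Res_W C̄_S) →+ ℚ/ℤ`, the `Res`-axiom `inv_W ∘ Res = [G_S:W] · inv_S` and the fields of
`TateDualityHypothesesAt p` at every open normal subgroup are the sequel (`IdeleClassBarSInvariantSubgroup`).

Cell `bsd-eis`, background lane «PT-Ш-S-TC» of crux `GoodLatticeBDPValue` (stmt-BirchSwinnertonDyer-19032), brick D2-CF,
seat bsd-line-x1-p1-w5 g10.  HONEST FRAMING: class field theory bookkeeping; no duality theorem, no case of Poitou–Tate and
no case of BSD is proved here.

## References
* J.-P. Serre, *Local Fields*, GTM 67 (1979), XI §2 Proposition 1, §3. [SerreLocalFields1979]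
* D. Harari, *Galois Cohomology and Class Field Theory* (2020), §16.1 Def. 16.3, §16.3 Lemma 16.20, §17.1 Thm. 17.2.
  [Harari2020]
* J.-P. Serre, *Galois Cohomology* (1997), I §2.2 Proposition 8 (cohomology of an open subgroup as a limit over the
  traces of the open normal subgroups). [SerreGaloisCohomology1997]
* J. Neukirch, A. Schmidt, K. Wingberg, *Cohomology of Number Fields* (2nd ed. 2008), VIII §3 (8.3.8). [NeukirchSchmidtWingberg2008]
-/

noncomputable section

open NumberField IsDedekindDomain CategoryTheory CategoryTheory.Limits groupCohomology
open Field (absoluteGaloisGroup)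
open Literature.NumberTheory.Automorphic Literature.NumberTheory.Automorphic.IdeleClassGroup
open Literature.NumberTheory.NumberFields
open Literature.Algebra.Homology Literature.Algebra.Homology.DiscreteRep
open Literature.NumberTheory.GaloisRepresentations.LocalWeilDatum (galFixing)
open scoped Classical

namespace Literature.NumberTheory.GaloisRepresentations

namespace IdeleClassBar

variable {K : Type} [Field K] [NumberField K] (S : Finset (HeightOneSpectrum (𝓞 K)))

/-! ## §1. The transition on the relative layers and the two squares -/

section Squares

variable {E E' : GalLayer K}
  (hE : ramificationSubgroup K (↑S : Set (HeightOneSpectrum (𝓞 K))) ≤ galFixing K E.1)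
  (hE' : ramificationSubgroup K (↑S : Set (HeightOneSpectrum (𝓞 K))) ≤ galFixing K E'.1)
  (W : Subgroup (GaloisGroupUnramifiedOutside K (↑S : Set (HeightOneSpectrum (𝓞 K)))))

/-- **The transition `C_S(E) → C_S(E')` read on the relative layers**: w4's `classModUnitsInflHom` as a pair morphism
`Res_{π'}(Res_{H_E} C_S(E)) ⟶ Res_{H_{E'}} C_S(E')` over bsd-line-x1-p1-w3's restriction `π' = subgroupImageSRes S W h hE hE' :
H_{E'} →* H_E` (the `j'` of `IdeleClassQuotientLayerVanishing`). [cite: Harari2020, §17.4 (17.1)][cite: NeukirchSchmidtWingberg2008, VIII §3 (8.3.9)] -/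
def relLayerInflHomS (h : E ≤ E') :
    haveI := E.numberField; haveI := E'.numberField; haveI := E.isGalois; letI := GalLayer.algebraOfLE h;
    haveI := GalLayer.isScalarTower_of_le h;
    Rep.res (subgroupImageSRes S W h hE hE')
        (Rep.res (subgroupImageS S hE W).subtype (IdeleCohomology.classModUnitsRep K E.1 S)) ⟶
      Rep.res (subgroupImageS S hE' W).subtype (IdeleCohomology.classModUnitsRep K E'.1 S) :=
  haveI := E.numberField
  haveI := E'.numberField
  haveI := E.isGalois
  letI := GalLayer.algebraOfLE h
  haveI := GalLayer.isScalarTower_of_le h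
  letI := (Rep.res (subgroupImageSRes S W h hE hE')
    (Rep.res (subgroupImageS S hE W).subtype (IdeleCohomology.classModUnitsRep K E.1 S))).hV2
  letI := (Rep.res (subgroupImageS S hE' W).subtype (IdeleCohomology.classModUnitsRep K E'.1 S)).hV2
  Rep.ofHom
    ⟨{ toFun := fun a => (IdeleCohomology.classModUnitsInflHom K E.1 E'.1 S).hom a
       map_add' := fun a b => map_add (IdeleCohomology.classModUnitsInflHom K E.1 E'.1 S).hom a b
       map_smul' := fun c a => by
         simp only [RingHom.id_apply]
         exact (congrArg (IdeleCohomology.classModUnitsInflHom K E.1 E'.1 S).hom (Int.cast_smul_eq_zsmul ℤ c a)).trans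
           ((map_zsmul (IdeleCohomology.classModUnitsInflHom K E.1 E'.1 S).hom c a).trans
             (Int.cast_smul_eq_zsmul ℤ c _).symm) },
     fun τ => LinearMap.ext fun x =>
       Rep.hom_comm_apply (IdeleCohomology.classModUnitsInflHom K E.1 E'.1 S) (τ : E'.1 ≃ₐ[K] E'.1) x⟩

/-- Formula: `relLayerInflHomS` is `classModUnitsInflHom` on vectors. [cite: Harari2020, §17.4 (17.1)] -/
theorem relLayerInflHomS_hom_apply (h : E ≤ E')
    (a : (haveI := E.numberField; (IdeleCohomology.classModUnitsRep K E.1 S).V)) :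
    (relLayerInflHomS S hE hE' W h).hom a =
      (haveI := E.numberField; haveI := E'.numberField; haveI := E.isGalois; letI := GalLayer.algebraOfLE h;
        haveI := GalLayer.isScalarTower_of_le h; (IdeleCohomology.classModUnitsInflHom K E.1 E'.1 S).hom a) := rfl

variable {W}
  (hEW : (layerSubgroupS S E : Subgroup (GaloisGroupUnramifiedOutside K (↑S : Set (HeightOneSpectrum (𝓞 K))))) ≤ W)
  (hE'W : (layerSubgroupS S E' : Subgroup (GaloisGroupUnramifiedOutside K (↑S : Set (HeightOneSpectrum (𝓞 K))))) ≤ W)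

set_option maxHeartbeats 800000 in
-- instance-path unification on the relative layer objects of `C̄_S` is slow (door-c6 g15's note; cf. `IdeleClassBarRelativeInvariant`)
/-- **The group homomorphisms agree**: `(↥W⧸(V̄_{E'}∩W) → ↥W⧸(V̄_E∩W)) ∘ subgroupImageSEquiv_{E'}⁻¹ = subgroupImageSEquiv_E⁻¹ ∘ π'`
as maps `H_{E'} → ↥W ⧸ (V̄_E ∩ W)` (both send `w|_{E'}` to `[w]`). [cite: SerreGaloisCohomology1997, I §2.2 Proposition 8] -/
theorem quotMap_comp_subgroupImageSEquiv_symm (h : E ≤ E') :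
    (DiscreteRep.quotMap (DiscreteRep.traceOpenNormalSubgroup W (layerSubgroupS S E) : Subgroup W)
        (DiscreteRep.traceOpenNormalSubgroup W (layerSubgroupS S E') : Subgroup W)
        (DiscreteRep.traceOpenNormalSubgroup_mono W (layerSubgroupS_anti S h))).comp
        (subgroupImageSEquiv S hE' W).symm.toMonoidHom =
      (subgroupImageSEquiv S hE W).symm.toMonoidHom.comp (subgroupImageSRes S W h hE hE') := by
  refine MonoidHom.ext fun τ => ?_
  obtain ⟨q, rfl⟩ := (subgroupImageSEquiv S hE' W).surjective τ
  induction q using QuotientGroup.induction_on with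
  | H w =>
    rw [MonoidHom.comp_apply, MonoidHom.comp_apply, MulEquiv.coe_toMonoidHom, MulEquiv.coe_toMonoidHom,
      MulEquiv.symm_apply_apply, MulEquiv.eq_symm_apply, DiscreteRep.quotMap_mk, subgroupImageSEquiv_mk,
      subgroupImageSEquiv_mk]
    exact (subgroupImageSRes_toSubgroupImageS S W h hE hE' w).symm

set_option maxHeartbeats 3200000 in
-- two `groupCohomology.map` composites compared through `map_comp` / `map_congr'`; the `ℤ`-instance paths of the relative
-- layer objects make the unification slow (as in door-c6's `relLayerCohomologyIso_stepG` and `SUnitsRestrictedLayersTransitions`)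
/-- **`stepG (V̄_E ∩ W) (V̄_{E'} ∩ W) ≫ relIso_{E'} = relIso_E ≫ Hⁿ(π', j')`**: door-c4's transition between the trace layers of
`Res_W C̄_S` is, under w3's relative layer isomorphisms, the relative inflation `Hⁿ(H_E, C_S(E)) → Hⁿ(H_{E'}, C_S(E'))` along
`π' : H_{E'} → H_E` and the transition `C_S(E) → C_S(E')`.
[cite: SerreGaloisCohomology1997, I §2.2 Proposition 8][cite: Harari2020, §16.3 Lemma 16.20, §17.4 (17.1)] -/
theorem stepG_comp_relLayerSCohomologyIso (h : E ≤ E') (n : ℕ) :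
    LayerColimit.stepG (DiscreteRep.traceOpenNormalSubgroup W (layerSubgroupS S E))
        (DiscreteRep.traceOpenNormalSubgroup W (layerSubgroupS S E'))
        (DiscreteRep.traceOpenNormalSubgroup_mono W (layerSubgroupS_anti S h))
        ((DiscreteRep.resD ℤ W).obj (classBarSD K S)) n ≫ (relLayerSCohomologyIso S hE' hE'W n).hom =
      (relLayerSCohomologyIso S hE hEW n).hom ≫
        groupCohomology.map (subgroupImageSRes S W h hE hE') (relLayerInflHomS S hE hE' W h) n := by
  haveI := E.numberField
  haveI := E'.numberField
  haveI := E.isGalois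
  letI := GalLayer.algebraOfLE h
  haveI := GalLayer.isScalarTower_of_le h
  rw [relLayerSCohomologyIso, relLayerSCohomologyIso, groupCohomology.mapIso_hom, groupCohomology.mapIso_hom,
    ← groupCohomology.map_comp, ← groupCohomology.map_comp]
  refine Literature.Algebra.Homology.map_congr' (quotMap_comp_subgroupImageSEquiv_symm S hE hE' h) _ _ (fun z => ?_) n
  obtain ⟨x, rfl⟩ := exists_relToLayerS_symm_toLayerS_eq S hE hEW z
  change relLayerSEquiv S hE' hE'W
      ((DiscreteRep.invariantsStepIncl _ _ (DiscreteRep.traceOpenNormalSubgroup_mono W (layerSubgroupS_anti S h))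
        ((DiscreteRep.resD ℤ W).obj (classBarSD K S))).hom ((relToLayerS S hEW).symm (toLayerS S hE x))) =
    (IdeleCohomology.classModUnitsInflHom K E.1 E'.1 S).hom
      (relLayerSEquiv S hE hEW ((relToLayerS S hEW).symm (toLayerS S hE x)))
  rw [relLayerSEquiv_symm_toLayerS]
  exact (relLayerSEquiv_invariantsStepIncl S h hE hE' hEW x).trans (π_transHom_eq_classModUnitsInflHom S h x)

/-- Elementwise form of the transition square. [cite: SerreGaloisCohomology1997, I §2.2 Proposition 8] -/
theorem relLayerSCohomologyIso_hom_stepG (h : E ≤ E') (n : ℕ) (c : groupCohomology (relLayerRepS S W E) n) :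
    (relLayerSCohomologyIso S hE' hE'W n).hom
        (LayerColimit.stepG (DiscreteRep.traceOpenNormalSubgroup W (layerSubgroupS S E))
          (DiscreteRep.traceOpenNormalSubgroup W (layerSubgroupS S E'))
          (DiscreteRep.traceOpenNormalSubgroup_mono W (layerSubgroupS_anti S h))
          ((DiscreteRep.resD ℤ W).obj (classBarSD K S)) n c) =
      groupCohomology.map (subgroupImageSRes S W h hE hE') (relLayerInflHomS S hE hE' W h) n
        ((relLayerSCohomologyIso S hE hEW n).hom c) := by
  have hsq := congrArg (fun φ => φ c) (stepG_comp_relLayerSCohomologyIso S hE hE' hEW hE'W h n)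
  simpa only [ModuleCat.comp_apply] using hsq

set_option maxHeartbeats 800000 in
-- instance-path unification on the relative layer objects of `C̄_S` is slow (door-c6 g15's note; cf. `IdeleClassBarRelativeInvariant`)
/-- **The group homomorphisms of the restriction agree**: `traceQuotMap ∘ subgroupImageSEquiv⁻¹ = quotLayerSEquiv⁻¹ ∘ (H_E ≤ Gal(E/K))`
as maps `H_E → G_S ⧸ V̄_E` (both send `w|_E` to `[w]`). [cite: SerreGaloisCohomology1997, I §2.2 Proposition 8] -/
theorem traceQuotMap_comp_subgroupImageSEquiv_symm :
    (DiscreteRep.traceQuotMap W (layerSubgroupS S E)).comp (subgroupImageSEquiv S hE W).symm.toMonoidHom =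
      (quotLayerSEquiv S hE).symm.toMonoidHom.comp (subgroupImageS S hE W).subtype := by
  refine MonoidHom.ext fun τ => ?_
  obtain ⟨q, rfl⟩ := (subgroupImageSEquiv S hE W).surjective τ
  induction q using QuotientGroup.induction_on with
  | H w =>
    rw [MonoidHom.comp_apply, MonoidHom.comp_apply, MulEquiv.coe_toMonoidHom, MulEquiv.coe_toMonoidHom,
      MulEquiv.symm_apply_apply, MulEquiv.eq_symm_apply, DiscreteRep.traceQuotMap_mk, Subgroup.coe_subtype,
      coe_subgroupImageSEquiv_mk]
    rfl

set_option maxHeartbeats 3200000 in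
-- as above
/-- **`Hⁿ(traceQuotMap, traceLayerHom) ≫ relIso_E = absIso_E ≫ res_{H_E}`**: door-c4's restriction map between the layer of
`G_S` and the trace layer of `W` (`DiscreteRepLayerRestriction.extRes_inflG`) is, under w3's isomorphisms, the restriction
`Hⁿ(Gal(E/K), C_S(E)) → Hⁿ(H_E, Res C_S(E))` of the finite layer.
[cite: SerreGaloisCohomology1997, I §2.2 Proposition 8][cite: SerreLocalFields1979, Ch. XI §2 Proposition 1] -/
theorem map_traceQuotMap_comp_relLayerSCohomologyIso (n : ℕ) :
    groupCohomology.map (DiscreteRep.traceQuotMap W (layerSubgroupS S E))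
        (DiscreteRep.traceLayerHom W (layerSubgroupS S E) (classBarSD K S)) n ≫ (relLayerSCohomologyIso S hE hEW n).hom =
      (layerSCohomologyIso S hE n).hom ≫ groupCohomology.map (subgroupImageS S hE W).subtype
        (𝟙 (haveI := E.numberField; Rep.res (subgroupImageS S hE W).subtype (IdeleCohomology.classModUnitsRep K E.1 S))) n := by
  haveI := E.numberField
  rw [relLayerSCohomologyIso, layerSCohomologyIso, groupCohomology.mapIso_hom, groupCohomology.mapIso_hom,
    ← groupCohomology.map_comp, ← groupCohomology.map_comp]
  refine Literature.Algebra.Homology.map_congr' (traceQuotMap_comp_subgroupImageSEquiv_symm S hE (W := W)) _ _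
    (fun z => ?_) n
  change relLayerSEquiv S hE hEW ((DiscreteRep.traceLayerHom W (layerSubgroupS S E) (classBarSD K S)).hom z) =
    layerSModuleEquiv S hE z
  have h1 : relToLayerS S hEW ((DiscreteRep.traceLayerHom W (layerSubgroupS S E) (classBarSD K S)).hom z) = z :=
    Subtype.ext rfl
  rw [relLayerSEquiv_apply, h1]

/-- Elementwise form of the restriction square. [cite: SerreGaloisCohomology1997, I §2.2 Proposition 8] -/
theorem relLayerSCohomologyIso_hom_map_traceQuotMap (n : ℕ) (c : groupCohomology (layerRepS S E) n) :
    (relLayerSCohomologyIso S hE hEW n).hom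
        (groupCohomology.map (DiscreteRep.traceQuotMap W (layerSubgroupS S E))
          (DiscreteRep.traceLayerHom W (layerSubgroupS S E) (classBarSD K S)) n c) =
      groupCohomology.map (subgroupImageS S hE W).subtype
        (𝟙 (haveI := E.numberField; Rep.res (subgroupImageS S hE W).subtype (IdeleCohomology.classModUnitsRep K E.1 S))) n
        ((layerSCohomologyIso S hE n).hom c) := by
  have hsq := congrArg (fun φ => φ c) (map_traceQuotMap_comp_relLayerSCohomologyIso S hE hEW n)
  simpa only [ModuleCat.comp_apply] using hsq

end Squares

/-! ## §2. The relative layer invariants and the index bookkeeping -/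

section RelInv

variable {W : Subgroup (GaloisGroupUnramifiedOutside K (↑S : Set (HeightOneSpectrum (𝓞 K))))} {E E' : GalLayer K}
  (hE : ramificationSubgroup K (↑S : Set (HeightOneSpectrum (𝓞 K))) ≤ galFixing K E.1)
  (hEW : (layerSubgroupS S E : Subgroup (GaloisGroupUnramifiedOutside K (↑S : Set (HeightOneSpectrum (𝓞 K))))) ≤ W)

/-- **`[σ] ↦ σ|_E : G_S → Gal(E/K)` is onto** (`G_S ↠ G_S ⧸ V̄_E ≃* Gal(E/K)`). [cite: SerreGaloisCohomology1997, I §2.2 Proposition 8] -/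
theorem restrictHomS_surjective : Function.Surjective (restrictHomS S hE) :=
  (quotLayerSEquiv S hE).surjective.comp (QuotientGroup.mk'_surjective _)

/-- The kernel of `[σ] ↦ σ|_E` is `V̄_E`. [cite: SerreGaloisCohomology1997, I §2.2 Proposition 8] -/
theorem ker_restrictHomS :
    (restrictHomS S hE).ker = (layerSubgroupS S E : Subgroup (GaloisGroupUnramifiedOutside K (↑S : Set (HeightOneSpectrum (𝓞 K))))) :=
  Subgroup.ext fun g => by rw [MonoidHom.mem_ker]; exact restrictHomS_eq_one_iff S hE g

include hEW in
/-- **`[Gal(E/K) : H_E] = [G_S : W]`** for `V̄_E ≤ W` (`H_E` is the image of `W` under the surjection `[σ] ↦ σ|_E`, whose kernel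
`V̄_E` lies in `W`). [cite: SerreGaloisCohomology1997, I §2.2 Proposition 8] -/
theorem index_subgroupImageS : (subgroupImageS S hE W).index = W.index :=
  Subgroup.index_map_eq _ (restrictHomS_surjective S hE) (by rw [ker_restrictHomS S hE]; exact hEW)

include hEW in
/-- **`|H_E| · [G_S : W] = [E:K]`** for `V̄_E ≤ W`. [cite: SerreGaloisCohomology1997, I §2.2 Proposition 8] -/
theorem natCard_subgroupImageS_mul_index : Nat.card (subgroupImageS S hE W) * W.index = Module.finrank K E.1 := by
  haveI := E.finiteDimensional
  haveI := E.isGalois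
  rw [← index_subgroupImageS S hE hEW, Subgroup.card_mul_index, IsGalois.card_aut_eq_finrank]

include hE hEW in
/-- `[G_S : W] ≠ 0` as soon as `W` contains some `V̄_E`. [cite: SerreGaloisCohomology1997, I §2.2 Proposition 8] -/
theorem index_ne_zero_of_layerSubgroupS_le : W.index ≠ 0 := by
  haveI := E.finiteDimensional
  intro h
  have h' := natCard_subgroupImageS_mul_index S hE hEW
  rw [h, mul_zero] at h'
  exact Module.finrank_pos.ne' h'.symm

/-- **The index of the trace layer is `|H_E|`**: `[W : V̄_E ∩ W] = |H_E|` (`↥W ⧸ (V̄_E ∩ W) ≃* H_E`).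
[cite: SerreGaloisCohomology1997, I §2.2 Proposition 8] -/
theorem index_traceOpenNormalSubgroup_layerSubgroupS :
    (DiscreteRep.traceOpenNormalSubgroup W (layerSubgroupS S E) : Subgroup W).index = Nat.card (subgroupImageS S hE W) := by
  rw [Subgroup.index_eq_card, Nat.card_congr (subgroupImageSEquiv S hE W).toEquiv]

include hEW in
/-- **`|H_{E'}| = [E':E] · |H_E|`** for `E ≤ E'` inside `K_S` with `V̄_E ≤ W` (both sides times `[G_S : W]` equal `[E':K]`).
[cite: SerreLocalFields1979, Ch. XI §2 Proposition 1][cite: SerreGaloisCohomology1997, I §2.2 Proposition 8] -/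
theorem natCard_subgroupImageS_eq_mul (h : E ≤ E')
    (hE' : ramificationSubgroup K (↑S : Set (HeightOneSpectrum (𝓞 K))) ≤ galFixing K E'.1) :
    Nat.card (subgroupImageS S hE' W) =
      (letI := GalLayer.algebraOfLE h; Module.finrank E.1 E'.1) * Nat.card (subgroupImageS S hE W) := by
  letI := GalLayer.algebraOfLE h
  haveI := GalLayer.isScalarTower_of_le h
  haveI := E.finiteDimensional
  haveI := E'.finiteDimensional
  have hE'W : (layerSubgroupS S E' : Subgroup (GaloisGroupUnramifiedOutside K (↑S : Set (HeightOneSpectrum (𝓞 K))))) ≤ W :=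
    (layerSubgroupS_anti S h).trans hEW
  have h1 := natCard_subgroupImageS_mul_index S hE' hE'W
  have h2 := natCard_subgroupImageS_mul_index S hE hEW
  have h3 : Module.finrank K E'.1 = Module.finrank K E.1 * Module.finrank E.1 E'.1 := (Module.finrank_mul_finrank K E.1 E'.1).symm
  refine Nat.eq_of_mul_eq_mul_right (Nat.pos_of_ne_zero (index_ne_zero_of_layerSubgroupS_le S hE hEW)) ?_
  calc Nat.card (subgroupImageS S hE' W) * W.index
      = Module.finrank K E.1 * Module.finrank E.1 E'.1 := h1.trans h3
    _ = Module.finrank E.1 E'.1 * Nat.card (subgroupImageS S hE W) * W.index := by rw [← h2]; ring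

set_option maxHeartbeats 800000 in
-- instance-path unification on the relative layer objects of `C̄_S` is slow (door-c6 g15's note; cf. `IdeleClassBarRelativeInvariant`)
/-- **The invariant map of the relative layer at `E`** (`V̄_E ≤ W`):
`H²(↥W ⧸ (V̄_E ∩ W), (Res_W C̄_S)^{V̄_E ∩ W}) →+ ℚ/ℤ`, the class-module invariant `inv_{H_E}` (`res ū_{E/K} ↦ 1/|H_E|`) of
`(H_E, Res C_S(E))` transported along w3's `relLayerSCohomologyIso`.
[cite: SerreLocalFields1979, Ch. XI §3][cite: Harari2020, §16.1 Def. 16.3, §17.1 Thm. 17.2] -/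
def relLayerInvS : groupCohomology (relLayerRepS S W E) 2 →+ AddCircle (1 : ℚ) :=
  haveI := E.numberField
  haveI := E.isGalois
  ((IdeleCohomology.isClassModule_classModUnitsCocycle (F := K) (E := E.1) S
      (forall_isUnramifiedIn_of_insideKS S hE)).invSub (subgroupImageS S hE W)).comp
    (relLayerSCohomologyIso S hE hEW 2).hom.hom.toAddMonoidHom

set_option maxHeartbeats 800000 in
-- instance-path unification on the relative layer objects of `C̄_S` is slow (door-c6 g15's note; cf. `IdeleClassBarRelativeInvariant`)
/-- Formula. [cite: SerreLocalFields1979, Ch. XI §3] -/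
theorem relLayerInvS_apply (c : groupCohomology (relLayerRepS S W E) 2) :
    relLayerInvS S hE hEW c = (haveI := E.numberField; haveI := E.isGalois;
      (IdeleCohomology.isClassModule_classModUnitsCocycle (F := K) (E := E.1) S
        (forall_isUnramifiedIn_of_insideKS S hE)).invSub (subgroupImageS S hE W) ((relLayerSCohomologyIso S hE hEW 2).hom c)) := by
  rw [relLayerInvS, AddMonoidHom.coe_comp, Function.comp_apply, LinearMap.toAddMonoidHom_coe]

set_option maxHeartbeats 800000 in
-- instance-path unification on the relative layer objects of `C̄_S` is slow (door-c6 g15's note; cf. `IdeleClassBarRelativeInvariant`)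
/-- **`relLayerInvS` is injective** (`inv_{H_E}` is, `relLayerSCohomologyIso` is an isomorphism).
[cite: SerreLocalFields1979, Ch. XI §2 Proposition 1] -/
theorem relLayerInvS_injective : Function.Injective (relLayerInvS S hE hEW) := by
  haveI := E.numberField
  haveI := E.isGalois
  intro c c' h
  rw [relLayerInvS_apply, relLayerInvS_apply] at h
  have h' := IdeleCohomology.invSub_classModUnits_injective S (forall_isUnramifiedIn_of_insideKS S hE)
    (subgroupImageS S hE W) h
  have := congrArg (relLayerSCohomologyIso S hE hEW 2).inv h'
  rwa [← ModuleCat.comp_apply, ← ModuleCat.comp_apply, Iso.hom_inv_id, ModuleCat.id_apply, ModuleCat.id_apply] at this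

set_option maxHeartbeats 800000 in
-- instance-path unification on the relative layer objects of `C̄_S` is slow (door-c6 g15's note; cf. `IdeleClassBarRelativeInvariant`)
/-- **The range of `relLayerInvS` is `{q : |H_E| • q = 0} = (1/|H_E|)ℤ/ℤ`.** [cite: SerreLocalFields1979, Ch. XI §3][cite: Harari2020, §16.4 Remark 16.24 (b)] -/
theorem mem_range_relLayerInvS_iff (q : AddCircle (1 : ℚ)) :
    q ∈ Set.range (relLayerInvS S hE hEW) ↔ Nat.card (subgroupImageS S hE W) • q = 0 := by
  haveI := E.numberField
  haveI := E.isGalois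
  rw [← IdeleCohomology.mem_range_invSub_classModUnits_iff S (forall_isUnramifiedIn_of_insideKS S hE) (subgroupImageS S hE W)]
  constructor
  · rintro ⟨c, rfl⟩
    exact ⟨_, (relLayerInvS_apply S hE hEW c).symm⟩
  · rintro ⟨y, rfl⟩
    refine ⟨(relLayerSCohomologyIso S hE hEW 2).inv y, ?_⟩
    rw [relLayerInvS_apply, ← ModuleCat.comp_apply, Iso.inv_hom_id, ModuleCat.id_apply]

/-- The same with the index of the trace layer: range `= {q : [W : V̄_E ∩ W] • q = 0}` (the `hrange` shape of w7's engine
lemmas for the group `↥W`). [cite: Harari2020, §16.4 Remark 16.24 (b)] -/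
theorem mem_range_relLayerInvS_iff_index (q : AddCircle (1 : ℚ)) :
    q ∈ Set.range (relLayerInvS S hE hEW) ↔
      (DiscreteRep.traceOpenNormalSubgroup W (layerSubgroupS S E) : Subgroup W).index • q = 0 := by
  rw [index_traceOpenNormalSubgroup_layerSubgroupS S hE]
  exact mem_range_relLayerInvS_iff S hE hEW q

set_option maxHeartbeats 800000 in
-- instance-path unification on the relative layer objects of `C̄_S` is slow (door-c6 g15's note; cf. `IdeleClassBarRelativeInvariant`)
/-- **`relLayerInvS (Hⁿ(traceQuotMap, traceLayerHom) c) = [G_S : W] • layerInvS c`** — the finite-level `Res`-axiom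
`inv_{H_E} ∘ res = [Gal(E/K) : H_E] • inv_{E/K,S}` (this seat's `invSub_classModUnits_map_subtype`) read through the restriction
square and `[Gal(E/K) : H_E] = [G_S : W]`. [cite: SerreLocalFields1979, Ch. XI §2 Proposition 1][cite: MilneADT2006, I §1 (1.1)] -/
theorem relLayerInvS_map_traceQuotMap (c : groupCohomology (layerRepS S E) 2) :
    relLayerInvS S hE hEW (groupCohomology.map (DiscreteRep.traceQuotMap W (layerSubgroupS S E))
        (DiscreteRep.traceLayerHom W (layerSubgroupS S E) (classBarSD K S)) 2 c) = W.index • layerInvS S hE c := by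
  haveI := E.numberField
  haveI := E.isGalois
  rw [relLayerInvS_apply, relLayerSCohomologyIso_hom_map_traceQuotMap S hE hEW 2 c,
    IdeleCohomology.invSub_classModUnits_map_subtype, index_subgroupImageS S hE hEW, layerInvS_apply]

set_option maxHeartbeats 800000 in
-- instance-path unification on the relative layer objects of `C̄_S` is slow (door-c6 g15's note; cf. `IdeleClassBarRelativeInvariant`)
/-- **Compatibility of the relative invariants with door-c4's transitions**: for `E ≤ E'` inside `K_S` (`V̄_E ≤ W`),
`relLayerInvS_{E'} (stepG c) = relLayerInvS_E (c)` — under the isomorphisms the transition is `Hⁿ(π', j')` (§1), and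
`inv_{H_{E'}} ∘ Hⁿ(π', j') = inv_{H_E}` since `|H_{E'}| = [E':E] |H_E|` (this seat's `invSub_classModUnits_map_relative`).
[cite: SerreLocalFields1979, Ch. XI §2 Proposition 1, §3][cite: SerreGaloisCohomology1997, I §2.2 Proposition 8] -/
theorem relLayerInvS_stepG (h : E ≤ E')
    (hE' : ramificationSubgroup K (↑S : Set (HeightOneSpectrum (𝓞 K))) ≤ galFixing K E'.1)
    (hE'W : (layerSubgroupS S E' : Subgroup (GaloisGroupUnramifiedOutside K (↑S : Set (HeightOneSpectrum (𝓞 K))))) ≤ W)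
    (c : groupCohomology (relLayerRepS S W E) 2) :
    relLayerInvS S hE' hE'W (LayerColimit.stepG (DiscreteRep.traceOpenNormalSubgroup W (layerSubgroupS S E))
        (DiscreteRep.traceOpenNormalSubgroup W (layerSubgroupS S E'))
        (DiscreteRep.traceOpenNormalSubgroup_mono W (layerSubgroupS_anti S h))
        ((DiscreteRep.resD ℤ W).obj (classBarSD K S)) 2 c) = relLayerInvS S hE hEW c := by
  haveI := E.numberField
  haveI := E'.numberField
  haveI := E.isGalois
  haveI := E'.isGalois
  letI := GalLayer.algebraOfLE h
  haveI := GalLayer.isScalarTower_of_le h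
  rw [relLayerInvS_apply, relLayerInvS_apply, relLayerSCohomologyIso_hom_stepG S hE hE' hEW hE'W h 2 c]
  exact IdeleCohomology.invSub_classModUnits_map_relative S (subgroupImageS S hE' W) (subgroupImageS S hE W)
    (subgroupImageSRes S W h hE hE') (coe_subgroupImageSRes_apply S W h hE hE') (relLayerInflHomS S hE hE' W h)
    (relLayerInflHomS_hom_apply S hE hE' W h)
    (forall_isUnramifiedIn_of_insideKS S hE) (forall_isUnramifiedIn_of_insideKS S hE')
    (natCard_subgroupImageS_eq_mul S hE hEW h hE') _

end RelInv

end IdeleClassBar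

end Literature.NumberTheory.GaloisRepresentations

end
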